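import Summits.AtomisticToContinuum.Crystallization.Theorems.PalmUnimodularRigidityLayeredLawsSelectHcpCertificateDefs
import Literature.Probability.Process.PointStationaryLaw

/-!
# Crux `LayeredLawsSelectHcp` (stmt-AtomisticToContinuum-9226), line `mtp-prestress-split-ergodic-frame`:
# the atoms of a counting measure `count|S` are `S`

Registered sub-goal `tube_atoms_count_restrict` of the crux item (lead c2 reshape; certificate calculus).
The sample of an hcp-layered law is a.s. a counting measure `count|S`; correctors and chart averages are sums over
`rootedCharts μ = {X | IsRootedChart (atoms μ) X}`, so every downstream lemma starts by identifying `atoms (count|S) = S`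
(a point `y` carries mass under `count|S` iff `y ∈ S`, `Literature.Probability.Process.count_restrict_singleton_ne_zero_iff`),
whence `rootedCharts (count|S) = {X | IsRootedChart S X}`. [folklore]
-/

noncomputable section

namespace Summit.AtomisticToContinuum.Crystallization.Theorems.PalmUnimodularRigidity.LayeredLawsSelectHcp

open MeasureTheory Set

/-- **Atoms of a counting measure** (registered sub-goal of stmt-AtomisticToContinuum-9226): the points of positive mass of
`count|S` are exactly the points of `S`. [folklore] -/
theorem tube_atoms_count_restrict : ∀ S : Set (EuclideanSpace ℝ (Fin 3)), atoms ((MeasureTheory.Measure.count : MeasureTheory.Measure (EuclideanSpace ℝ (Fin 3))).restrict S) = S := by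
  intro S
  ext y
  exact Literature.Probability.Process.count_restrict_singleton_ne_zero_iff S y

/-- The rooted labelled charts of a counting measure `count|S` are the rooted labelled charts of `S`. [folklore] -/
theorem rootedCharts_count_restrict (S : Set (EuclideanSpace ℝ (Fin 3))) :
    rootedCharts ((Measure.count : Measure (EuclideanSpace ℝ (Fin 3))).restrict S) = {X | IsRootedChart S X} := by
  unfold rootedCharts
  rw [tube_atoms_count_restrict S]

/-- Membership form: `X` is a rooted labelled chart of `count|S` iff it is a rooted labelled chart of `S`. [folklore] -/
theorem mem_rootedCharts_count_restrict {S : Set (EuclideanSpace ℝ (Fin 3))}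
    {X : ℤ × ℤ × ℤ → EuclideanSpace ℝ (Fin 3)} :
    X ∈ rootedCharts ((Measure.count : Measure (EuclideanSpace ℝ (Fin 3))).restrict S) ↔ IsRootedChart S X := by
  rw [rootedCharts_count_restrict S, mem_setOf_eq]

end Summit.AtomisticToContinuum.Crystallization.Theorems.PalmUnimodularRigidity.LayeredLawsSelectHcp

end
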